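import Mathlib
import Literature.Computability.AlgebraicComplexity.SymmetricArithCircuit
import Literature.Computability.AlgebraicComplexity.ArithCircuit
import Literature.Computability.AlgebraicComplexity.CircuitGateSemantics
import Literature.Combinatorics.Enumerative.PermPrescribed
import HarnessLib

/-!
# Support symmetrisation of straight-line programs (coset-block symmetrisation): the circuit

Topic `Computability/AlgebraicComplexity`, namespace
`Literature.Computability.AlgebraicComplexity.SupportSymm`.

THE CONSTRUCTION. Let `P` be a straight-line program (tree `ArithCircuit`: a well-formed list of
unbounded fan-in weighted-sum and product gates over a field `F`, Bürgisser 2000, Def. 2.1) on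
the `n × n` variable matrix `x_{pq}`, annotated with SUPPORTS `K i ⊆ Fin n` of its gates
(`SupportedProgram`) such that

* the value `vᵢ` of gate `i` is invariant under the pointwise stabiliser of `K i` in the
  diagonal action `x_{pq} ↦ x_{σ p, σ q}` of `Sym(Fin n)` (hypothesis `hinv` of the theorems),
* product gates take only operands supported inside `K i` (hypothesis `hprod`;
  the support of an operand is `{p, q}` for `x_{pq}`, `∅` for a constant, `K j` for gate `j`),
* the output gate has empty support.

Its SUPPORT SYMMETRISATION (`SupportedProgram.circuit`) is the Dawar–Wilsenach labelled circuit
(`LabelledArithCircuit`, Dawar–Wilsenach 2025, Def. 2.2) with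

* input gates `var p q` (label `x_{pq}`) and `cst c`, one for each constant `c` of the finite set
  `consts` of constants used;
* for every gate `i` and every injection `κ : K i ↪ Fin n` a COPY `main i κ = [i, κ]`, labelled
  `+` / `×` like gate `i`, which computes `ren ρ vᵢ` for any permutation `ρ ⊇ κ` (well defined
  by invariance; proved in the companion file);
* for every operand position `t` of gate `i` a multiplication gadget
  `argM i κ t = cst (coef i t) × argS i κ t` and an addition gadget
  `argS i κ t = Σ (copies of the operand u_t along the partial injections μ of supp u_t that are
  COMPATIBLE with κ)` — `μ` agrees with `κ` on `supp u_t ∩ K i` and avoids `κ(K i)` elsewhere,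
  i.e. `κ ∪ μ` extends to a permutation (`Compat`, `compatSet`); the children of `[i, κ]` are the
  `argM i κ t`;
* the constant `coef i t = a_t · (n - |K i ∪ supp u_t|)! / (n - |K i|)!` (`a_t` the weight of
  the operand, `1` for a product gate, for which the quotient is `1` as `supp u_t ⊆ K i`).

`Sym(Fin n)` acts by `[i, κ] ↦ [i, σ ∘ κ]`, `x_{pq} ↦ x_{σ p, σ q}` (`SupportedProgram.perm`).
The companion file `SupportSymmetrisationEval.lean` proves that this is a circuit automorphism
(the circuit is `Sym(Fin n)`-symmetric, Def. 3.7), that `[i, κ]` computes `ren ρ vᵢ` — for a sum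
gate this is the AVERAGING IDENTITY over the coset `{θ : θ ⊇ κ}` decomposed along the
restrictions `θ|supp u_t`, each compatible `μ` being hit `(n - |K i ∪ supp u_t|)!` times
(`sum_extSet_eq_smul_sum_compatSet` below, from
`Literature.Combinatorics.Enumerative.card_permsPrescribed`), valid in characteristic `0` — and
the size bound `3 (W + 1)(2A + 1)(n + 1)^(k + 2)` for `W` gates of fan-in `≤ A` and supports of
size `≤ k` (gate `i` has `n (n-1) ⋯ (n-|K i|+1) ≤ (n+1)^k` copies).

This is the "easy" (converse) direction of the support theorems for symmetric circuits: gates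
with supports of size `≤ k` can be laid out as an explicitly symmetric circuit with one copy per
injection of the support into the universe (Dawar–Pago–Seppelt 2025, §5, the circuits built in
the proof of Thm 5.3 have "for every tuple `v ∈ [n]^ℓ` a gate which computes `F(v)`";
Anderson–Dawar 2017, §4, for the Boolean setting; the hard direction — symmetric circuits of
small orbit size have small supports — is the support theorem of Anderson–Dawar and
Dawar–Wilsenach). Here it is carried out for arbitrary supported straight-line programs, the
form used by the monotone-restoration route of summit ValiantsHypothesis.

## Contents

* per-gate program semantics in indexed form (`arity`, `operand`, `coeff`, `gateEval_eq_sum`,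
  `gateEval_eq_prod`, `getD_gateValues_of_refsBelow`), on top of `CircuitGateSemantics`;
* partial injections of `Fin n`: `resEmb`, `Compat`, `compatSet`, `extSet` and the counting
  lemmas `card_filter_extends_and`, `card_extSet`, `sum_extSet_eq_smul_sum_compatSet`;
* `SupportedProgram`, the gate type `Node`, `copy`, `children`, `label`, acyclicity via `rank`,
  the circuit `circuit`, the action `perm` of `Sym(Fin n)` on the gates.

## What is NOT here

Rigidity of the circuit and minimality of the supports are not claimed; the circuit has
unbounded fan-in (as `LabelledArithCircuit` allows). No named facts: everything is proved.
Decidability is classical throughout (`Node` carries field constants).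

## References

* A. Dawar, B. Pago, T. Seppelt, *Symmetric Algebraic Circuits and Homomorphism Polynomials*,
  arXiv:2502.06740 (2025), §5. [DawarPagoSeppelt2025]
* M. Anderson, A. Dawar, *On Symmetric Circuits and Fixed-Point Logics*, Theory Comput. Syst.
  60 (2017), §4. [AndersonDawar2016]
* A. Dawar, G. Wilsenach, *Symmetric Arithmetic Circuits*, Theory of Computing 21 (2025),
  Defs. 2.2, 3.6, 3.7. [DawarWilsenach2025]
* P. Bürgisser, *Completeness and Reduction in Algebraic Complexity Theory*, Springer 2000,
  Def. 2.1. [Burgisser2000]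
-/

noncomputable section

open scoped Classical

namespace Literature.Computability.AlgebraicComplexity

open MvPolynomial

universe u v

/-! ### Straight-line program semantics: well-formed gates read all values; gates as indexed sums -/

namespace SupportSymm

section Program

variable {k : Type u} {σ : Type v} [CommSemiring k]

/-- An operand referring only to gates `< i` reads the same value from the first `i` values
(Bürgisser 2000, Def. 2.1: instruction `i` uses only earlier results). [folklore] -/
theorem operandEval_take_of_refsBelow (vals : List (MvPolynomial σ k)) {i : ℕ}
    {u : ArithCircuit.Operand k σ} (hu : u.RefsBelow i) : u.eval (vals.take i) = u.eval vals := by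
  cases u with
  | var _ => rfl
  | const _ => rfl
  | gate j =>
    change j < i at hu
    simp only [ArithCircuit.Operand.eval, List.getD_eq_getElem?_getD, List.getElem?_take_of_lt hu]

/-- A gate referring only to gates `< i` evaluates the same against the first `i` values.
[folklore] -/
theorem gateEval_take_of_refsBelow (vals : List (MvPolynomial σ k)) {i : ℕ}
    {g : ArithCircuit.Gate k σ} (hg : ∀ u ∈ g.args, u.RefsBelow i) :
    g.eval (vals.take i) = g.eval vals := by
  cases g with
  | sum args =>
    simp only [ArithCircuit.Gate.eval]
    congr 1
    refine List.map_congr_left fun a ha => ?_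
    rw [operandEval_take_of_refsBelow vals (hg a.2 (List.mem_map_of_mem ha))]
  | prod args =>
    simp only [ArithCircuit.Gate.eval]
    congr 1
    refine List.map_congr_left fun u hu => ?_
    rw [operandEval_take_of_refsBelow vals (hg u hu)]

/-- In a well-formed gate list, the `i`-th value is the `i`-th gate evaluated against ALL values
(per-gate semantics `ArithCircuit.gateValues_getElem?` plus well-formedness). [folklore] -/
theorem getD_gateValues_of_refsBelow (gs : List (ArithCircuit.Gate k σ)) {i : ℕ}
    (hi : i < gs.length) (hg : ∀ u ∈ (gs[i]).args, u.RefsBelow i) :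
    (ArithCircuit.gateValues gs).getD i 0 = (gs[i]).eval (ArithCircuit.gateValues gs) := by
  rw [List.getD_eq_getElem?_getD,
    ArithCircuit.gateValues_getElem? gs i _ (List.getElem?_eq_getElem hi), Option.getD_some,
    ArithCircuit.gateValues_take_eq_take, gateEval_take_of_refsBelow _ hg]

/-- The arity (number of operands) of a gate, by pattern matching (equal to `fanIn`, see
`arity_eq_length_args`). [folklore] -/
def arity : ArithCircuit.Gate k σ → ℕ
  | .sum args => args.length
  | .prod args => args.length

/-- The `t`-th operand of a gate. [folklore] -/
def operand : (g : ArithCircuit.Gate k σ) → Fin (arity g) → ArithCircuit.Operand k σ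
  | .sum args, t => (args[t.1]'t.2).2
  | .prod args, t => args[t.1]'t.2

/-- The `t`-th coefficient of a gate: the `t`-th weight of a sum gate, `1` for a product gate.
[folklore] -/
def coeff : (g : ArithCircuit.Gate k σ) → Fin (arity g) → k
  | .sum args, t => (args[t.1]'t.2).1
  | .prod _, _ => 1

omit [CommSemiring k] in
/-- `arity = |args|`. [folklore] -/
theorem arity_eq_length_args (g : ArithCircuit.Gate k σ) : arity g = g.args.length := by
  cases g <;> simp [arity, ArithCircuit.Gate.args]

omit [CommSemiring k] in
/-- Operands are members of the operand list. [folklore] -/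
theorem operand_mem_args (g : ArithCircuit.Gate k σ) (t : Fin (arity g)) :
    operand g t ∈ g.args := by
  cases g with
  | sum args => exact List.mem_map_of_mem (List.getElem_mem t.2)
  | prod args => exact List.getElem_mem t.2

/-- A sum gate is the weighted sum of its operands, indexed by position. [folklore] -/
theorem gateEval_eq_sum (vals : List (MvPolynomial σ k)) (g : ArithCircuit.Gate k σ)
    (hg : g.isProd = false) :
    g.eval vals = ∑ t : Fin (arity g), coeff g t • (operand g t).eval vals := by
  cases g with
  | prod _ => simp [ArithCircuit.Gate.isProd] at hg
  | sum args =>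
    show (args.map fun a => a.1 • a.2.eval vals).sum =
      ∑ t : Fin args.length, (args[t.1]).1 • (args[t.1]).2.eval vals
    exact (Fin.sum_univ_fun_getElem args (fun a => a.1 • a.2.eval vals)).symm

/-- A product gate is the product of its operands, indexed by position. [folklore] -/
theorem gateEval_eq_prod (vals : List (MvPolynomial σ k)) (g : ArithCircuit.Gate k σ)
    (hg : g.isProd = true) : g.eval vals = ∏ t : Fin (arity g), (operand g t).eval vals := by
  cases g with
  | sum _ => simp [ArithCircuit.Gate.isProd] at hg
  | prod args =>
    show (args.map fun u => u.eval vals).prod = ∏ t : Fin args.length, (args[t.1]).eval vals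
    exact (Fin.prod_univ_fun_getElem args _).symm

/-- The coefficients of a product gate are `1`. [folklore] -/
theorem coeff_of_isProd (g : ArithCircuit.Gate k σ) (hg : g.isProd = true) (t : Fin (arity g)) :
    coeff g t = 1 := by
  cases g with
  | sum _ => simp [ArithCircuit.Gate.isProd] at hg
  | prod _ => rfl

end Program

end SupportSymm

/-! ### Permutations of `Fin n`: the diagonal renaming, compatible partial injections, counting -/

namespace SupportSymm

variable {n : ℕ}

/-- The diagonal action of `σ ∈ Sym(Fin n)` on matrix positions: `(p, q) ↦ (σ p, σ q)`.
[folklore] -/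
def diag (σ : Equiv.Perm (Fin n)) : Fin n × Fin n → Fin n × Fin n :=
  fun pq => (σ pq.1, σ pq.2)

/-- `diag σ (p, q) = (σ p, σ q)`. [folklore] -/
@[simp] theorem diag_apply (σ : Equiv.Perm (Fin n)) (pq : Fin n × Fin n) :
    diag σ pq = (σ pq.1, σ pq.2) := rfl

/-- `diag` is multiplicative. [folklore] -/
theorem diag_mul (σ τ : Equiv.Perm (Fin n)) : diag (σ * τ) = diag σ ∘ diag τ := rfl

/-- `diag 1 = id`. [folklore] -/
theorem diag_one : diag (1 : Equiv.Perm (Fin n)) = id := rfl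

section Rename

variable {F : Type u} [CommSemiring F]

/-- Renaming along `diag` is an action: `ren σ (ren τ w) = ren (σ τ) w`. [folklore] -/
theorem rename_diag_rename_diag (σ τ : Equiv.Perm (Fin n)) (w : MvPolynomial (Fin n × Fin n) F) :
    rename (diag σ) (rename (diag τ) w) = rename (diag (σ * τ)) w := by
  rw [rename_rename, diag_mul]

/-- `ren 1 = id`. [folklore] -/
theorem rename_diag_one (w : MvPolynomial (Fin n × Fin n) F) :
    rename (diag (1 : Equiv.Perm (Fin n))) w = w := by
  rw [diag_one, rename_id_apply]

/-- A polynomial invariant under the pointwise stabiliser of `S` is renamed identically by any two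
permutations that agree on `S`. [folklore] -/
theorem rename_diag_eq_of_agree (S : Finset (Fin n)) {w : MvPolynomial (Fin n × Fin n) F}
    (hw : ∀ σ : Equiv.Perm (Fin n), (∀ x ∈ S, σ x = x) → rename (diag σ) w = w)
    {θ θ' : Equiv.Perm (Fin n)} (h : ∀ x ∈ S, θ x = θ' x) :
    rename (diag θ) w = rename (diag θ') w := by
  have key : rename (diag (θ'⁻¹ * θ)) w = w := hw _ fun x hx => by
    rw [Equiv.Perm.mul_apply, h x hx]
    simp
  calc rename (diag θ) w = rename (diag (θ' * (θ'⁻¹ * θ))) w := by rw [mul_inv_cancel_left]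
    _ = rename (diag θ') (rename (diag (θ'⁻¹ * θ)) w) := (rename_diag_rename_diag _ _ _).symm
    _ = rename (diag θ') w := by rw [key]

end Rename

/-- Restriction of a permutation to a finite set, as an injection `↥S ↪ Fin n`. [folklore] -/
def resEmb (S : Finset (Fin n)) (θ : Equiv.Perm (Fin n)) : ↥S ↪ Fin n :=
  ⟨fun x => θ x, fun _ _ h => Subtype.ext (θ.injective h)⟩

/-- `resEmb S θ x = θ x`. [folklore] -/
@[simp] theorem resEmb_apply (S : Finset (Fin n)) (θ : Equiv.Perm (Fin n)) (x : ↥S) :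
    resEmb S θ x = θ x := rfl

/-- Restricting a product. [folklore] -/
theorem resEmb_mul (S : Finset (Fin n)) (σ θ : Equiv.Perm (Fin n)) :
    resEmb S (σ * θ) = (resEmb S θ).trans σ.toEmbedding := by
  ext x; rfl

/-- The inclusion `↥S ↪ Fin n`. [folklore] -/
def inclEmb (S : Finset (Fin n)) : ↥S ↪ Fin n := resEmb S 1

/-- `inclEmb S x = x`. [folklore] -/
@[simp] theorem inclEmb_apply (S : Finset (Fin n)) (x : ↥S) : inclEmb S x = x := rfl

/-- Restriction of an injection `↥Ki ↪ Fin n` to a subset `S ⊆ Ki`. [folklore] -/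
def restrEmb {Ki S : Finset (Fin n)} (κ : ↥Ki ↪ Fin n) (h : S ⊆ Ki) : ↥S ↪ Fin n :=
  ⟨fun x => κ ⟨x, h x.2⟩, fun x y hxy => by
    have hxy' := congrArg Subtype.val (κ.injective hxy)
    exact Subtype.ext hxy'⟩

/-- `restrEmb κ h x = κ x`. [folklore] -/
@[simp] theorem restrEmb_apply {Ki S : Finset (Fin n)} (κ : ↥Ki ↪ Fin n) (h : S ⊆ Ki)
    (x : ↥S) :
    restrEmb κ h x = κ ⟨x, h x.2⟩ := rfl

/-- `θ` extends the partial injection `κ` on `Ki`. [folklore] -/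
def Extends (Ki : Finset (Fin n)) (κ : ↥Ki ↪ Fin n) (θ : Equiv.Perm (Fin n)) : Prop :=
  ∀ y : ↥Ki, θ y = κ y

/-- **Compatibility** of a partial injection `μ` on `S` with a partial injection `κ` on `Ki`:
they agree on `S ∩ Ki`, and `μ` avoids the image `κ(Ki)` on `S ∖ Ki` — exactly the condition
for `κ` and `μ` to have a common extension to a permutation. [folklore] -/
def Compat (Ki : Finset (Fin n)) (κ : ↥Ki ↪ Fin n) (S : Finset (Fin n)) (μ : ↥S ↪ Fin n) :
    Prop :=
  (∀ (x : ↥S) (hx : (x : Fin n) ∈ Ki), μ x = κ ⟨x, hx⟩) ∧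
    ∀ x : ↥S, (x : Fin n) ∉ Ki → ∀ y : ↥Ki, μ x ≠ κ y

/-- The finite set of partial injections on `S` compatible with `(Ki, κ)`. [folklore] -/
def compatSet (Ki : Finset (Fin n)) (κ : ↥Ki ↪ Fin n) (S : Finset (Fin n)) :
    Finset (↥S ↪ Fin n) :=
  Finset.univ.filter (Compat Ki κ S)

/-- Membership in `compatSet`. [folklore] -/
@[simp] theorem mem_compatSet {Ki : Finset (Fin n)} {κ : ↥Ki ↪ Fin n} {S : Finset (Fin n)}
    {μ : ↥S ↪ Fin n} : μ ∈ compatSet Ki κ S ↔ Compat Ki κ S μ := by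
  simp [compatSet]

/-- The finite set (coset) of permutations extending `κ`. [folklore] -/
def extSet (Ki : Finset (Fin n)) (κ : ↥Ki ↪ Fin n) : Finset (Equiv.Perm (Fin n)) :=
  Finset.univ.filter (Extends Ki κ)

/-- Membership in `extSet`. [folklore] -/
@[simp] theorem mem_extSet {Ki : Finset (Fin n)} {κ : ↥Ki ↪ Fin n} {θ : Equiv.Perm (Fin n)} :
    θ ∈ extSet Ki κ ↔ Extends Ki κ θ := by
  simp [extSet]

/-- The restriction of an extension of `κ` is compatible with `κ`. [folklore] -/
theorem compat_resEmb {Ki : Finset (Fin n)} {κ : ↥Ki ↪ Fin n} {θ : Equiv.Perm (Fin n)}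
    (h : Extends Ki κ θ) (S : Finset (Fin n)) : Compat Ki κ S (resEmb S θ) := by
  refine ⟨fun x hx => h ⟨x, hx⟩, fun x hx y hxy => hx ?_⟩
  rw [resEmb_apply, ← h y] at hxy
  rw [θ.injective hxy]
  exact y.2

/-- Compatibility is equivariant under left translation by a permutation. [folklore] -/
theorem compat_trans_iff {Ki : Finset (Fin n)} (κ : ↥Ki ↪ Fin n) {S : Finset (Fin n)}
    (μ : ↥S ↪ Fin n) (σ : Equiv.Perm (Fin n)) :
    Compat Ki (κ.trans σ.toEmbedding) S (μ.trans σ.toEmbedding) ↔ Compat Ki κ S μ := by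
  simp [Compat]

/-- On a subset `S ⊆ Ki` the only compatible partial injection is the restriction of `κ`.
[folklore] -/
theorem compat_iff_of_subset {Ki S : Finset (Fin n)} (κ : ↥Ki ↪ Fin n) (h : S ⊆ Ki)
    (μ : ↥S ↪ Fin n) : Compat Ki κ S μ ↔ μ = restrEmb κ h := by
  constructor
  · intro hc
    exact Function.Embedding.ext fun x => hc.1 x (h x.2)
  · rintro rfl
    exact ⟨fun _ _ => rfl, fun x hx => (hx (h x.2)).elim⟩

/-- For `S ⊆ Ki`, `compatSet Ki κ S = {restrEmb κ h}`. [folklore] -/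
theorem compatSet_eq_singleton_of_subset {Ki S : Finset (Fin n)} (κ : ↥Ki ↪ Fin n)
    (h : S ⊆ Ki) :
    compatSet Ki κ S = {restrEmb κ h} := by
  ext μ
  rw [mem_compatSet, Finset.mem_singleton, compat_iff_of_subset κ h]

/-- Translating the compatible set: `μ ↦ σ ∘ μ` maps `compatSet Ki κ S` onto
`compatSet Ki (σ ∘ κ) S`. [folklore] -/
theorem compatSet_image_trans {Ki : Finset (Fin n)} (κ : ↥Ki ↪ Fin n) (S : Finset (Fin n))
    (σ : Equiv.Perm (Fin n)) :
    (compatSet Ki κ S).image (fun μ => μ.trans σ.toEmbedding) =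
      compatSet Ki (κ.trans σ.toEmbedding) S := by
  ext μ'
  simp only [Finset.mem_image, mem_compatSet]
  constructor
  · rintro ⟨μ, hμ, rfl⟩
    exact (compat_trans_iff κ μ σ).2 hμ
  · intro h
    refine ⟨μ'.trans σ⁻¹.toEmbedding, ?_, ?_⟩
    · rw [← compat_trans_iff κ _ σ]
      convert h using 1
      ext x; simp
    · ext x; simp

/-- The glued partial map: `κ` on `Ki`, `μ` on `S`, identity elsewhere. [folklore] -/
def glue (Ki : Finset (Fin n)) (κ : ↥Ki ↪ Fin n) (S : Finset (Fin n)) (μ : ↥S ↪ Fin n) :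
    Fin n → Fin n :=
  fun x => if hx : x ∈ Ki then κ ⟨x, hx⟩ else if hs : x ∈ S then μ ⟨x, hs⟩ else x

/-- A permutation extends both `κ` and `μ` iff it agrees with the glued map on `Ki ∪ S`
(for compatible `μ`). [folklore] -/
theorem extends_and_iff_glue {Ki : Finset (Fin n)} {κ : ↥Ki ↪ Fin n} {S : Finset (Fin n)}
    {μ : ↥S ↪ Fin n} (hc : Compat Ki κ S μ) (θ : Equiv.Perm (Fin n)) :
    (Extends Ki κ θ ∧ ∀ x : ↥S, θ x = μ x) ↔
      ∀ x ∈ Ki ∪ S, θ x = glue Ki κ S μ x := by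
  constructor
  · rintro ⟨h1, h2⟩ x hx
    unfold glue
    split_ifs with hK hS
    · exact h1 ⟨x, hK⟩
    · exact h2 ⟨x, hS⟩
    · exact absurd (Finset.mem_union.1 hx) (not_or.2 ⟨hK, hS⟩)
  · intro h
    refine ⟨fun y => ?_, fun x => ?_⟩
    · have := h y (Finset.mem_union_left _ y.2)
      unfold glue at this
      rw [dif_pos y.2] at this
      exact this
    · have := h x (Finset.mem_union_right _ x.2)
      unfold glue at this
      by_cases hK : (x : Fin n) ∈ Ki
      · rw [dif_pos hK] at this
        rw [this, hc.1 x hK]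
      · rw [dif_neg hK, dif_pos x.2] at this
        exact this

/-- The glued map of a compatible pair is injective on `Ki ∪ S`. [folklore] -/
theorem glue_injOn {Ki : Finset (Fin n)} {κ : ↥Ki ↪ Fin n} {S : Finset (Fin n)}
    {μ : ↥S ↪ Fin n} (hc : Compat Ki κ S μ) : Set.InjOn (glue Ki κ S μ) ↑(Ki ∪ S) := by
  intro x hx y hy hxy
  simp only [Finset.coe_union, Set.mem_union, Finset.mem_coe] at hx hy
  unfold glue at hxy
  by_cases hxK : x ∈ Ki <;> by_cases hyK : y ∈ Ki
  · rw [dif_pos hxK, dif_pos hyK] at hxy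
    exact congrArg Subtype.val (κ.injective hxy)
  · have hyS : y ∈ S := hy.resolve_left hyK
    rw [dif_pos hxK, dif_neg hyK, dif_pos hyS] at hxy
    exact absurd hxy.symm (hc.2 ⟨y, hyS⟩ hyK ⟨x, hxK⟩)
  · have hxS : x ∈ S := hx.resolve_left hxK
    rw [dif_neg hxK, dif_pos hxS, dif_pos hyK] at hxy
    exact absurd hxy (hc.2 ⟨x, hxS⟩ hxK ⟨y, hyK⟩)
  · have hxS : x ∈ S := hx.resolve_left hxK
    have hyS : y ∈ S := hy.resolve_left hyK
    rw [dif_neg hxK, dif_pos hxS, dif_neg hyK, dif_pos hyS] at hxy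
    exact congrArg Subtype.val (μ.injective hxy)

/-- **Counting common extensions.** A compatible pair `(κ on Ki, μ on S)` has exactly
`(n - |Ki ∪ S|)!` common extensions to a permutation of `Fin n`
(`Literature.Combinatorics.Enumerative.card_permsPrescribed`). [folklore] -/
theorem card_filter_extends_and {Ki : Finset (Fin n)} {κ : ↥Ki ↪ Fin n} {S : Finset (Fin n)}
    {μ : ↥S ↪ Fin n} (hc : Compat Ki κ S μ) :
    ((extSet Ki κ).filter fun θ => ∀ x : ↥S, θ x = μ x).card =
      (n - (Ki ∪ S).card).factorial := by
  have h := Literature.Combinatorics.Enumerative.card_permsPrescribed (Ki ∪ S) (glue_injOn hc)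
  rw [Fintype.card_fin] at h
  rw [← h]
  congr 1
  ext θ
  rw [Finset.mem_filter, mem_extSet, Literature.Combinatorics.Enumerative.mem_permsPrescribed,
    extends_and_iff_glue hc]

/-- The coset of extensions of `κ` has `(n - |Ki|)!` elements. [folklore] -/
theorem card_extSet (Ki : Finset (Fin n)) (κ : ↥Ki ↪ Fin n) :
    (extSet Ki κ).card = (n - Ki.card).factorial := by
  have hc : Compat Ki κ ∅ (resEmb ∅ 1) :=
    ⟨fun x => absurd x.2 (Finset.notMem_empty _), fun x => absurd x.2 (Finset.notMem_empty _)⟩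
  have h := card_filter_extends_and hc
  rw [Finset.union_empty] at h
  rw [← h]
  congr 1
  ext θ
  simp only [Finset.mem_filter, iff_self_and]
  exact fun _ x => absurd x.2 (Finset.notMem_empty _)

/-- Every partial injection extends to a permutation. [folklore] -/
theorem extSet_nonempty (Ki : Finset (Fin n)) (κ : ↥Ki ↪ Fin n) : (extSet Ki κ).Nonempty := by
  rw [← Finset.card_pos, card_extSet]
  exact Nat.factorial_pos _

/-- A compatible pair has a common extension. [folklore] -/
theorem exists_extends_of_compat {Ki : Finset (Fin n)} {κ : ↥Ki ↪ Fin n} {S : Finset (Fin n)}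
    {μ : ↥S ↪ Fin n} (hc : Compat Ki κ S μ) :
    ∃ θ : Equiv.Perm (Fin n), Extends Ki κ θ ∧ ∀ x : ↥S, θ x = μ x := by
  have h : ((extSet Ki κ).filter fun θ => ∀ x : ↥S, θ x = μ x).Nonempty := by
    rw [← Finset.card_pos, card_filter_extends_and hc]
    exact Nat.factorial_pos _
  obtain ⟨θ, hθ⟩ := h
  rw [Finset.mem_filter, mem_extSet] at hθ
  exact ⟨θ, hθ⟩

/-- The compatible set is nonempty (restrict any extension of `κ`). [folklore] -/
theorem compatSet_nonempty (Ki : Finset (Fin n)) (κ : ↥Ki ↪ Fin n) (S : Finset (Fin n)) :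
    (compatSet Ki κ S).Nonempty := by
  obtain ⟨θ, hθ⟩ := extSet_nonempty Ki κ
  exact ⟨resEmb S θ, mem_compatSet.2 (compat_resEmb (mem_extSet.1 hθ) S)⟩

/-- Restricting extensions of `κ` maps the coset into the compatible set. [folklore] -/
theorem resEmb_mem_compatSet {Ki : Finset (Fin n)} {κ : ↥Ki ↪ Fin n} (S : Finset (Fin n))
    {θ : Equiv.Perm (Fin n)} (hθ : θ ∈ extSet Ki κ) : resEmb S θ ∈ compatSet Ki κ S :=
  mem_compatSet.2 (compat_resEmb (mem_extSet.1 hθ) S)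

/-- **Averaging over a coset, fibrewise.** Summing `g (θ|S)` over all extensions `θ` of `κ`
counts every compatible `μ` exactly `(n - |Ki ∪ S|)!` times. [folklore] -/
theorem sum_extSet_eq_smul_sum_compatSet {M : Type*} [AddCommMonoid M] (Ki : Finset (Fin n))
    (κ : ↥Ki ↪ Fin n) (S : Finset (Fin n)) (g : (↥S ↪ Fin n) → M) :
    ∑ θ ∈ extSet Ki κ, g (resEmb S θ) =
      (n - (Ki ∪ S).card).factorial • ∑ μ ∈ compatSet Ki κ S, g μ := by
  rw [← Finset.sum_fiberwise_of_maps_to' (g := resEmb S)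
      (fun θ hθ => resEmb_mem_compatSet S hθ), Finset.smul_sum]
  refine Finset.sum_congr rfl fun μ hμ => ?_
  rw [Finset.sum_const]
  congr 1
  rw [← card_filter_extends_and (mem_compatSet.1 hμ)]
  congr 1
  ext θ
  simp only [Finset.mem_filter, and_congr_right_iff]
  intro _
  constructor
  · intro h x
    rw [← h]; rfl
  · intro h
    exact Function.Embedding.ext fun x => h x

/-! ### Supported straight-line programs -/

/-- The support of an operand, relative to a support annotation `K` of the gates: the two indices
of a variable `x_{pq}`, nothing for a constant, `K j` for a reference to gate `j`. [folklore] -/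
def osupp (K : ℕ → Finset (Fin n)) {F : Type u} :
    ArithCircuit.Operand F (Fin n × Fin n) → Finset (Fin n)
  | .var pq => {pq.1, pq.2}
  | .const _ => ∅
  | .gate j => K j

/-- The constant of a constant operand (as a finite set). [folklore] -/
def opConst {F : Type u} : ArithCircuit.Operand F (Fin n × Fin n) → Finset F
  | .const c => {c}
  | _ => ∅

/-- A **supported straight-line program** on the `n × n` variable matrix: a gate list (tree
`ArithCircuit.Gate`: unbounded fan-in weighted sums and products) that is well formed (gate `i`
refers only to gates `< i`) with non-nullary gates, a support annotation
`supp : ℕ → Finset (Fin n)` and an output gate `out`. The semantic side conditions (invariance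
of gate `i` under the pointwise stabiliser of `supp i`, hereditary supports of product gates,
empty support of the output) are explicit hypotheses of the theorems about it
(Dawar–Pago–Seppelt 2025 §5, converse direction; Anderson–Dawar supports).
[cite: DawarPagoSeppelt2025, §5] -/
structure SupportedProgram (F : Type u) (n : ℕ) : Type u where
  /-- The gates, in topological order. -/
  gates : List (ArithCircuit.Gate F (Fin n × Fin n))
  /-- The support annotation. -/
  supp : ℕ → Finset (Fin n)
  /-- The output gate. -/
  out : ℕ
  /-- The output gate exists. -/
  out_lt : out < gates.length
  /-- No gate is nullary. -/
  args_ne_nil : ∀ g ∈ gates, g.args ≠ []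
  /-- Gate `i` refers only to gates `< i`. -/
  refsBelow : ∀ (i : ℕ) (g : ArithCircuit.Gate F (Fin n × Fin n)), gates[i]? = some g →
    ∀ u ∈ g.args, u.RefsBelow i

namespace SupportedProgram

variable {F : Type u} [Field F] (P : SupportedProgram F n)

/-- Gate number `i`. [folklore] -/
def gate (i : Fin P.gates.length) : ArithCircuit.Gate F (Fin n × Fin n) := P.gates[(i : ℕ)]

/-- The value list of the program. [folklore] -/
def vals : List (MvPolynomial (Fin n × Fin n) F) := ArithCircuit.gateValues P.gates

/-- The value of gate `i` (junk `0` out of range). [folklore] -/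
def val (i : ℕ) : MvPolynomial (Fin n × Fin n) F := P.vals.getD i 0

omit [Field F] in
/-- `gates[i]? = some (gate i)`. [folklore] -/
theorem getElem?_gates (i : Fin P.gates.length) : P.gates[(i : ℕ)]? = some (P.gate i) :=
  List.getElem?_eq_getElem i.2

omit [Field F] in
/-- Operands of gate `i` refer to gates `< i`. [folklore] -/
theorem refsBelow_operand (i : Fin P.gates.length) (t : Fin (arity (P.gate i))) :
    (operand (P.gate i) t).RefsBelow i :=
  P.refsBelow i (P.gate i) (P.getElem?_gates i) _ (operand_mem_args (P.gate i) t)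

omit [Field F] in
/-- Gates have positive arity. [folklore] -/
theorem arity_pos (i : Fin P.gates.length) : 0 < arity (P.gate i) := by
  rw [arity_eq_length_args]
  exact List.length_pos_iff.2 (P.args_ne_nil _ (List.getElem_mem i.2))

/-- The value of gate `i` is gate `i` evaluated against all values (well-formedness). [folklore] -/
theorem val_eq_eval (i : Fin P.gates.length) : P.val i = (P.gate i).eval P.vals :=
  getD_gateValues_of_refsBelow P.gates i.2
    (P.refsBelow i _ (List.getElem?_eq_getElem i.2))

/-- The support of the `t`-th operand of gate `i`. [folklore] -/
abbrev osuppAt (i : Fin P.gates.length) (t : Fin (arity (P.gate i))) : Finset (Fin n) :=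
  osupp P.supp (operand (P.gate i) t)

/-- The averaging constant `(n - |Ki ∪ S|)! / (n - |Ki|)!` of the coset decomposition.
[folklore] -/
def avgConst (Ki S : Finset (Fin n)) : F :=
  ((n - (Ki ∪ S).card).factorial : F) / ((n - Ki.card).factorial : F)

/-- The constant of the `t`-th operand gadget of gate `i`: weight times averaging constant.
[folklore] -/
def coef (i : Fin P.gates.length) (t : Fin (arity (P.gate i))) : F :=
  coeff (P.gate i) t * avgConst (P.supp i) (P.osuppAt i t)

/-- The finite set of constants used by the symmetrised circuit: `1`, the constant operands,
and the gadget constants. [folklore] -/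
def consts : Finset F :=
  insert 1 (Finset.univ.biUnion fun i : Fin P.gates.length =>
    Finset.univ.biUnion fun t : Fin (arity (P.gate i)) =>
      insert (P.coef i t) (opConst (operand (P.gate i) t)))

/-- `1 ∈ consts`. [folklore] -/
theorem one_mem_consts : (1 : F) ∈ P.consts := Finset.mem_insert_self _ _

/-- Gadget constants are in `consts`. [folklore] -/
theorem coef_mem_consts (i : Fin P.gates.length) (t : Fin (arity (P.gate i))) :
    P.coef i t ∈ P.consts := by
  refine Finset.mem_insert_of_mem (Finset.mem_biUnion.2 ⟨i, Finset.mem_univ _, ?_⟩)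
  exact Finset.mem_biUnion.2 ⟨t, Finset.mem_univ _, Finset.mem_insert_self _ _⟩

/-- Constant operands are in `consts`. [folklore] -/
theorem mem_consts_of_operand_eq (i : Fin P.gates.length) (t : Fin (arity (P.gate i))) {c : F}
    (h : operand (P.gate i) t = .const c) : c ∈ P.consts := by
  refine Finset.mem_insert_of_mem (Finset.mem_biUnion.2 ⟨i, Finset.mem_univ _, ?_⟩)
  refine Finset.mem_biUnion.2 ⟨t, Finset.mem_univ _, Finset.mem_insert_of_mem ?_⟩
  rw [h]
  exact Finset.mem_singleton_self c

/-- The constants contributed by one gate number at most `2 · arity`. [folklore] -/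
theorem card_biUnion_consts_le (i : Fin P.gates.length) :
    ((Finset.univ : Finset (Fin (arity (P.gate i)))).biUnion fun t =>
      insert (P.coef i t) (opConst (operand (P.gate i) t))).card ≤ 2 * arity (P.gate i) := by
  calc ((Finset.univ : Finset (Fin (arity (P.gate i)))).biUnion fun t =>
      insert (P.coef i t) (opConst (operand (P.gate i) t))).card
      ≤ ∑ t : Fin (arity (P.gate i)),
          (insert (P.coef i t) (opConst (operand (P.gate i) t))).card := Finset.card_biUnion_le
    _ ≤ ∑ _t : Fin (arity (P.gate i)), 2 := Finset.sum_le_sum fun t _ => by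
        have h1 : (opConst (operand (P.gate i) t)).card ≤ 1 := by
          cases operand (P.gate i) t <;> simp [opConst]
        have h2 := Finset.card_insert_le (P.coef i t) (opConst (operand (P.gate i) t))
        omega
    _ = 2 * arity (P.gate i) := by simp [mul_comm]

/-- `|consts| ≤ 1 + 2 Σ_i arity i`. [folklore] -/
theorem card_consts_le :
    P.consts.card ≤ 1 + ∑ i : Fin P.gates.length, 2 * arity (P.gate i) := by
  calc P.consts.card ≤ (Finset.univ.biUnion fun i : Fin P.gates.length =>
      Finset.univ.biUnion fun t : Fin (arity (P.gate i)) =>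
        insert (P.coef i t) (opConst (operand (P.gate i) t))).card + 1 := Finset.card_insert_le _ _
    _ ≤ (∑ i : Fin P.gates.length, 2 * arity (P.gate i)) + 1 := by
        refine Nat.add_le_add_right (le_trans Finset.card_biUnion_le ?_) 1
        exact Finset.sum_le_sum fun i _ => P.card_biUnion_consts_le i
    _ = 1 + ∑ i : Fin P.gates.length, 2 * arity (P.gate i) := add_comm _ _

/-! ### The gates of the symmetrised circuit -/

/-- Gates of the support symmetrisation of `P`: the `n²` variable inputs, one constant input per
element of `consts`, and for every program gate `i` and every injection `κ : supp i ↪ Fin n` a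
main gate `[i, κ]` together with, for every operand position `t`, a multiplication gadget
`argM i κ t = const × argS i κ t` and an addition gadget `argS i κ t` summing all compatible
copies of the operand. [cite: DawarPagoSeppelt2025, §5] -/
inductive Node (P : SupportedProgram F n) : Type u
  /-- Input gate of the variable `x_{pq}`. -/
  | var (p q : Fin n) : Node P
  /-- Input gate of a constant. -/
  | cst (c : ↥P.consts) : Node P
  /-- The copy `[i, κ]` of program gate `i`. -/
  | main (i : Fin P.gates.length) (κ : ↥(P.supp i) ↪ Fin n) : Node P
  /-- The multiplication gadget of operand `t` of `[i, κ]`. -/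
  | argM (i : Fin P.gates.length) (κ : ↥(P.supp i) ↪ Fin n) (t : Fin (arity (P.gate i))) :
      Node P
  /-- The addition gadget of operand `t` of `[i, κ]`. -/
  | argS (i : Fin P.gates.length) (κ : ↥(P.supp i) ↪ Fin n) (t : Fin (arity (P.gate i))) :
      Node P

/-- The gates as a sum type (for counting). [folklore] -/
def Node.equivSum : Node P ≃ (Fin n × Fin n) ⊕ ↥P.consts ⊕
    (Σ i : Fin P.gates.length, ↥(P.supp i) ↪ Fin n) ⊕
    (Σ i : Fin P.gates.length, (↥(P.supp i) ↪ Fin n) × Fin (arity (P.gate i))) ⊕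
    (Σ i : Fin P.gates.length, (↥(P.supp i) ↪ Fin n) × Fin (arity (P.gate i))) where
  toFun
    | .var p q => Sum.inl (p, q)
    | .cst c => Sum.inr (Sum.inl c)
    | .main i κ => Sum.inr (Sum.inr (Sum.inl ⟨i, κ⟩))
    | .argM i κ t => Sum.inr (Sum.inr (Sum.inr (Sum.inl ⟨i, (κ, t)⟩)))
    | .argS i κ t => Sum.inr (Sum.inr (Sum.inr (Sum.inr ⟨i, (κ, t)⟩)))
  invFun
    | Sum.inl pq => .var pq.1 pq.2
    | Sum.inr (Sum.inl c) => .cst c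
    | Sum.inr (Sum.inr (Sum.inl ⟨i, κ⟩)) => .main i κ
    | Sum.inr (Sum.inr (Sum.inr (Sum.inl ⟨i, (κ, t)⟩))) => .argM i κ t
    | Sum.inr (Sum.inr (Sum.inr (Sum.inr ⟨i, (κ, t)⟩))) => .argS i κ t
  left_inv g := by cases g <;> rfl
  right_inv s := by
    rcases s with ⟨p, q⟩ | c | ⟨i, κ⟩ | ⟨i, κ, t⟩ | ⟨i, κ, t⟩ <;> rfl

/-- Finitely many gates. [folklore] -/
instance Node.instFintype : Fintype (Node P) := Fintype.ofEquiv _ (Node.equivSum P).symm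

/-- Equality of gates is decided classically (gates carry constants of the field `F`); this
instance is pinned so that all files elaborate `Finset` operations on gates alike. [folklore] -/
instance Node.instDecidableEq : DecidableEq (Node P) := Classical.decEq _

variable {P}

/-- The copy of an operand `u` along a partial injection `μ` of its support: the variable
`x_{μ p, μ q}`, the constant itself, or the copy `[j, μ]` of gate `j` (junk: the constant `1` for
an out-of-range reference or an unknown constant, which do not occur in `P`). [folklore] -/
def copy :
    (u : ArithCircuit.Operand F (Fin n × Fin n)) → (↥(osupp P.supp u) ↪ Fin n) → Node P
  | .var pq, μ => .var (μ ⟨pq.1, by simp [osupp]⟩) (μ ⟨pq.2, by simp [osupp]⟩)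
  | .const c, _ => if h : c ∈ P.consts then .cst ⟨c, h⟩ else .cst ⟨1, P.one_mem_consts⟩
  | .gate j, μ =>
    if h : j < P.gates.length then .main ⟨j, h⟩ μ else .cst ⟨1, P.one_mem_consts⟩

variable (P)

/-- Children: inputs have none; `[i, κ]` has the gadgets `argM i κ t`; `argM i κ t` has the
constant `coef i t` and `argS i κ t`; `argS i κ t` has all copies of operand `t` along partial
injections compatible with `κ`. [cite: DawarPagoSeppelt2025, §5] -/
def children : Node P → Finset (Node P)
  | .var _ _ => ∅
  | .cst _ => ∅
  | .main i κ => Finset.univ.image fun t => .argM i κ t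
  | .argM i κ t => {.cst ⟨P.coef i t, P.coef_mem_consts i t⟩, .argS i κ t}
  | .argS i κ t => (compatSet (P.supp i) κ (P.osuppAt i t)).image (copy (operand (P.gate i) t))

/-- The label of a main gate: `+` for a sum gate, `×` for a product gate. [folklore] -/
def mainLabel : ArithCircuit.Gate F (Fin n × Fin n) → CircuitLabel F (Fin n × Fin n)
  | .sum _ => .add
  | .prod _ => .mul

/-- Labels. [folklore] -/
def label : Node P → CircuitLabel F (Fin n × Fin n)
  | .var p q => .var (p, q)
  | .cst c => .const c.1
  | .main i _ => mainLabel (P.gate i)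
  | .argM _ _ _ => .mul
  | .argS _ _ _ => .add

/-- Rank, for acyclicity: inputs `0`, `argS i ↦ 3i+1`, `argM i ↦ 3i+2`, `[i, κ] ↦ 3i+3`.
[folklore] -/
def rank : Node P → ℕ
  | .var _ _ => 0
  | .cst _ => 0
  | .main i _ => 3 * i + 3
  | .argM i _ _ => 3 * i + 2
  | .argS i _ _ => 3 * i + 1

variable {P}

/-- Copies of an operand referring below `i` have rank `≤ 3 i`. [folklore] -/
theorem rank_copy_le {i : ℕ} (u : ArithCircuit.Operand F (Fin n × Fin n))
    (μ : ↥(osupp P.supp u) ↪ Fin n) (hr : u.RefsBelow i) : P.rank (copy u μ) ≤ 3 * i := by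
  cases u with
  | var pq => simp [copy, rank]
  | const c => simp only [copy]; split_ifs <;> simp [rank]
  | gate j =>
    change j < i at hr
    simp only [copy]
    split_ifs
    · simp only [rank]; omega
    · simp [rank]

/-- Children have smaller rank. [folklore] -/
theorem rank_lt_of_mem_children {g h : Node P} (hh : h ∈ P.children g) : P.rank h < P.rank g := by
  cases g with
  | var p q => simp [children] at hh
  | cst c => simp [children] at hh
  | main i κ =>
    simp only [children, Finset.mem_image, Finset.mem_univ, true_and] at hh
    obtain ⟨t, rfl⟩ := hh
    simp [rank]
  | argM i κ t =>
    simp only [children, Finset.mem_insert, Finset.mem_singleton] at hh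
    rcases hh with rfl | rfl <;> simp [rank]
  | argS i κ t =>
    simp only [children, Finset.mem_image] at hh
    obtain ⟨μ, -, rfl⟩ := hh
    have := rank_copy_le _ μ (P.refsBelow_operand i t)
    change P.rank _ < 3 * (i : ℕ) + 1
    omega

omit [Field F] in
/-- The mainLabel is never an input label. [folklore] -/
theorem not_isInput_mainLabel (g : ArithCircuit.Gate F (Fin n × Fin n)) :
    ¬ (mainLabel g).IsInput := by
  cases g <;> simp [mainLabel]

/-- Input labels exactly at the gates without children. [folklore] -/
theorem isInput_iff (g : Node P) : (P.label g).IsInput ↔ P.children g = ∅ := by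
  cases g with
  | var p q => simp [label, children]
  | cst c => simp [label, children]
  | main i κ =>
    simp only [label, not_isInput_mainLabel, children, Finset.image_eq_empty,
      Finset.univ_eq_empty_iff, false_iff, not_isEmpty_iff]
    exact ⟨⟨0, P.arity_pos i⟩⟩
  | argM i κ t => simp [label, children]
  | argS i κ t =>
    simp only [label, CircuitLabel.not_isInput_add, children, Finset.image_eq_empty, false_iff]
    exact (compatSet_nonempty _ _ _).ne_empty

/-- Labels are injective on input gates. [folklore] -/
theorem eq_of_label_eq (g g' : Node P) (hg : (P.label g).IsInput) (h : P.label g = P.label g') :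
    g = g' := by
  cases g with
  | var p q =>
    cases g' with
    | var p' q' => simp only [label, CircuitLabel.var.injEq, Prod.mk.injEq] at h; rw [h.1, h.2]
    | cst c => simp [label] at h
    | main i κ => exact absurd (h ▸ hg) (not_isInput_mainLabel _)
    | argM i κ t => simp [label] at h
    | argS i κ t => simp [label] at h
  | cst c =>
    cases g' with
    | var p' q' => simp [label] at h
    | cst c' => simp only [label, CircuitLabel.const.injEq] at h; rw [Subtype.ext h]
    | main i κ => exact absurd (h ▸ hg) (not_isInput_mainLabel _)
    | argM i κ t => simp [label] at h
    | argS i κ t => simp [label] at h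
  | main i κ => exact absurd hg (not_isInput_mainLabel _)
  | argM i κ t => simp [label] at hg
  | argS i κ t => simp [label] at hg

variable (P)

/-- **The support symmetrisation of `P`** as a Dawar–Wilsenach labelled circuit: output the copy
`[out, incl]` of the output gate. [cite: DawarPagoSeppelt2025, §5] -/
def circuit : LabelledArithCircuit F (Fin n × Fin n) Unit (Node P) where
  children := P.children
  label := P.label
  output := fun _ => .main ⟨P.out, P.out_lt⟩ (inclEmb (P.supp P.out))
  wf := Subrelation.wf (fun {_ _} hh => rank_lt_of_mem_children hh)
    (InvImage.wf P.rank Nat.lt_wfRel.wf)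
  isInput_iff := isInput_iff
  eq_of_label_eq := eq_of_label_eq
  output_injective := fun a b _ => Subsingleton.elim a b

/-! ### Symmetry -/

omit [Field F] in
/-- `(κ σ) σ⁻¹ = κ`. [folklore] -/
theorem trans_trans_symm {α : Type*} (κ : α ↪ Fin n) (σ : Equiv.Perm (Fin n)) :
    (κ.trans σ.toEmbedding).trans σ⁻¹.toEmbedding = κ :=
  Function.Embedding.ext fun x => by simp

omit [Field F] in
/-- `(κ σ⁻¹) σ = κ`. [folklore] -/
theorem trans_symm_trans {α : Type*} (κ : α ↪ Fin n) (σ : Equiv.Perm (Fin n)) :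
    (κ.trans σ⁻¹.toEmbedding).trans σ.toEmbedding = κ :=
  Function.Embedding.ext fun x => by simp

/-- The automorphism of the gates induced by `σ ∈ Sym(Fin n)`: variables move diagonally,
constants are fixed, and the copy `[i, κ]` (with its gadgets) goes to `[i, σ ∘ κ]`.
[cite: DawarPagoSeppelt2025, §5] -/
def perm (σ : Equiv.Perm (Fin n)) : Equiv.Perm (Node P) where
  toFun
    | .var p q => .var (σ p) (σ q)
    | .cst c => .cst c
    | .main i κ => .main i (κ.trans σ.toEmbedding)
    | .argM i κ t => .argM i (κ.trans σ.toEmbedding) t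
    | .argS i κ t => .argS i (κ.trans σ.toEmbedding) t
  invFun
    | .var p q => .var (σ⁻¹ p) (σ⁻¹ q)
    | .cst c => .cst c
    | .main i κ => .main i (κ.trans σ⁻¹.toEmbedding)
    | .argM i κ t => .argM i (κ.trans σ⁻¹.toEmbedding) t
    | .argS i κ t => .argS i (κ.trans σ⁻¹.toEmbedding) t
  left_inv g := by cases g <;> simp [trans_trans_symm]
  right_inv g := by cases g <;> simp [trans_symm_trans]

/-- `perm` on variable gates. [folklore] -/
@[simp] theorem perm_var (σ : Equiv.Perm (Fin n)) (p q : Fin n) :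
    P.perm σ (.var p q) = .var (σ p) (σ q) := rfl

/-- `perm` on constant gates. [folklore] -/
@[simp] theorem perm_cst (σ : Equiv.Perm (Fin n)) (c : ↥P.consts) :
    P.perm σ (.cst c) = .cst c := rfl

/-- `perm` on main gates. [folklore] -/
@[simp] theorem perm_main (σ : Equiv.Perm (Fin n)) (i : Fin P.gates.length)
    (κ : ↥(P.supp i) ↪ Fin n) :
    P.perm σ (.main i κ) = .main i (κ.trans σ.toEmbedding) := rfl

/-- `perm` on multiplication gadgets. [folklore] -/
@[simp] theorem perm_argM (σ : Equiv.Perm (Fin n)) (i : Fin P.gates.length)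
    (κ : ↥(P.supp i) ↪ Fin n) (t : Fin (arity (P.gate i))) :
    P.perm σ (.argM i κ t) = .argM i (κ.trans σ.toEmbedding) t := rfl

/-- `perm` on addition gadgets. [folklore] -/
@[simp] theorem perm_argS (σ : Equiv.Perm (Fin n)) (i : Fin P.gates.length)
    (κ : ↥(P.supp i) ↪ Fin n) (t : Fin (arity (P.gate i))) :
    P.perm σ (.argS i κ t) = .argS i (κ.trans σ.toEmbedding) t := rfl

end SupportedProgram

end SupportSymm

end Literature.Computability.AlgebraicComplexity

end
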